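import Mathlib
import Summits.Ventures.PercRepro2.Tail2DBlockCalc
import Summits.Ventures.PercRepro2.Tail2DHarrisSP
import Summits.Ventures.PercRepro2.Tail2DFlowOneBlocks
import Summits.Ventures.PercRepro2.Tail2DFlowOnePar
import Summits.Ventures.PercRepro2.Tail2DSDomSwap
import Summits.Ventures.PercRepro2.Tail2DFlowOneStep01
import Summits.Ventures.PercRepro2.Tail2DFlowOneThreeCounts

/-!
# Row-tails and column-tails, and the tails of `X ∥ Y` for a flow-one `X`
(seat mine-b, cell pub-perc-repro2; conjectures/MINE-B.md §45)

The ROW-TAIL `D(1,0) = {r ≥ 1, b = 0}` of a network (`rowTail`) is a LOWER set and the COLUMN-TAIL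
`Dc(0,1) = {r = 0, b ≥ 1}` (`colTail`) an UPPER set (`r` antitone, `b` monotone), with `E(1,0) = D(1,0) ⊔ E(1,1)`,
`E(0,1) = Dc(0,1) ⊔ E(1,1)` and `#Dc = #D` (the colour swap).  On `X ∥ Y` with `X` flow-one (letters `R`, `B`,
`C` of sizes `a`, `a`, `c`) the tails are the product unions `E(2,0) = R × E_Y(1,0) ⊔ col × E_Y(2,0)`,
`E(1,1) = R × E_Y(0,1) ⊔ B × E_Y(1,0) ⊔ C × E_Y(1,1)`, `E(1,0) = R × all ⊔ col × E_Y(1,0)`, with the counts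
`tailCount_par_20_left`, `tailCount_par_11_left`, `tailCount_par_10_left`.  These are the blocks and counts of the
one-factor relay step of (SD) at `(2,0)` (`Tail2DRelay20.lean`).
-/

namespace Summit.Ventures.PercRepro2.Tail2D

open V2Closure Finset

section RowTail

variable (Y : V2Closure.SP)

/-- the row-tail `D(1,0) = {r ≥ 1, b = 0}`: a red crossing and no blue one -/
def rowTail : Finset Y.Conf := Finset.univ.filter (fun y : Y.Conf => 1 ≤ Y.rLab y ∧ Y.bLab y = 0)

/-- the column-tail `Dc(0,1) = {r = 0, b ≥ 1}`: a blue crossing and no red one -/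
def colTail : Finset Y.Conf := Finset.univ.filter (fun y : Y.Conf => Y.rLab y = 0 ∧ 1 ≤ Y.bLab y)

/-- membership in the row-tail -/
theorem mem_rowTail (y : Y.Conf) : y ∈ rowTail Y ↔ 1 ≤ Y.rLab y ∧ Y.bLab y = 0 := by
  simp [rowTail]

/-- membership in the column-tail -/
theorem mem_colTail (y : Y.Conf) : y ∈ colTail Y ↔ Y.rLab y = 0 ∧ 1 ≤ Y.bLab y := by
  simp [colTail]

/-- the row-tail is a lower set (`r` antitone, `b` monotone) -/
theorem rowTail_lower : ∀ x y : Y.Conf, x ≤ y → y ∈ rowTail Y → x ∈ rowTail Y := by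
  intro x y hxy hy
  rw [mem_rowTail] at hy ⊢
  have h1 := rLab_antitone Y hxy
  have h2 := bLab_monotone Y hxy
  omega

/-- the column-tail is an upper set -/
theorem colTail_upper : ∀ x y : Y.Conf, x ≤ y → x ∈ colTail Y → y ∈ colTail Y := by
  intro x y hxy hx
  rw [mem_colTail] at hx ⊢
  have h1 := rLab_antitone Y hxy
  have h2 := bLab_monotone Y hxy
  omega

/-- `E(1,0) = D(1,0) ⊔ E(1,1)`: `#D + T(1,1) = T(1,0)` -/
theorem card_rowTail_add : (rowTail Y).card + tailCount Y 1 1 = tailCount Y 1 0 := by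
  rw [tailCount_eq_card, tailCount_eq_card, ← Finset.card_union_of_disjoint]
  · congr 1
    ext y
    simp only [Finset.mem_union, mem_rowTail, mem_tailSet_iff]
    omega
  · rw [Finset.disjoint_left]
    intro y h1 h2
    rw [mem_rowTail] at h1
    rw [mem_tailSet_iff] at h2
    omega

/-- `E(0,1) = Dc(0,1) ⊔ E(1,1)`: `#Dc + T(1,1) = T(0,1)` -/
theorem card_colTail_add : (colTail Y).card + tailCount Y 1 1 = tailCount Y 0 1 := by
  rw [tailCount_eq_card, tailCount_eq_card, ← Finset.card_union_of_disjoint]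
  · congr 1
    ext y
    simp only [Finset.mem_union, mem_colTail, mem_tailSet_iff]
    omega
  · rw [Finset.disjoint_left]
    intro y h1 h2
    rw [mem_colTail] at h1
    rw [mem_tailSet_iff] at h2
    omega

/-- the row-tail and the column-tail have the same size (the colour swap) -/
theorem card_colTail_eq : (colTail Y).card = (rowTail Y).card := by
  have h1 := card_rowTail_add Y
  have h2 := card_colTail_add Y
  have h3 := tailCount_symm Y 0 1
  omega

end RowTail

section Counts

variable (X Y : V2Closure.SP)

/-- `E(2,0)` of `X ∥ Y` for flow-one `X`: `R × E_Y(1,0) ⊔ col × E_Y(2,0)` -/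
theorem tailSet_par_20_left (hX : FlowOne X) :
    tailSet (V2Closure.SP.par X Y) 2 0
      = ((rSet X ×ˢ tailSet Y 1 0 : Finset (X.Conf × Y.Conf))
          ∪ (colSet X ×ˢ tailSet Y 2 0 : Finset (X.Conf × Y.Conf))) := by
  apply Finset.ext; intro p
  rw [mem_tailSet_par']
  refine Iff.trans ?_ Finset.mem_union.symm
  refine Iff.trans ?_ (or_congr Finset.mem_product Finset.mem_product).symm
  rw [mem_rSet, mem_colSet, mem_tailSet_iff, mem_tailSet_iff]
  have := hX p.1
  omega

/-- `#E(2,0) = a T_Y(1,0) + (n − a) T_Y(2,0)` -/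
theorem tailCount_par_20_left (hX : FlowOne X) :
    tailCount (V2Closure.SP.par X Y) 2 0
      = (rSet X).card * tailCount Y 1 0 + (Fintype.card X.Conf - (rSet X).card) * tailCount Y 2 0 := by
  rw [tailCount_eq_card, tailSet_par_20_left X Y hX]
  show ((rSet X ×ˢ tailSet Y 1 0 : Finset (X.Conf × Y.Conf))
      ∪ (colSet X ×ˢ tailSet Y 2 0 : Finset (X.Conf × Y.Conf))).card = _
  rw [Finset.card_union_of_disjoint, Finset.card_product, Finset.card_product, card_colSet X hX,
    tailCount_eq_card, tailCount_eq_card]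
  rw [Finset.disjoint_left]
  intro p h1 h2
  rw [Finset.mem_product, mem_rSet] at h1
  rw [Finset.mem_product, mem_colSet] at h2
  omega

/-- `E(1,1)` of `X ∥ Y` for flow-one `X`: `R × E_Y(0,1) ⊔ B × E_Y(1,0) ⊔ C × E_Y(1,1)` -/
theorem tailSet_par_11_left (hX : FlowOne X) :
    tailSet (V2Closure.SP.par X Y) 1 1
      = (((rSet X ×ˢ tailSet Y 0 1 : Finset (X.Conf × Y.Conf))
          ∪ (bSet X ×ˢ tailSet Y 1 0 : Finset (X.Conf × Y.Conf)))
          ∪ (cellSet X ×ˢ tailSet Y 1 1 : Finset (X.Conf × Y.Conf))) := by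
  apply Finset.ext; intro p
  rw [mem_tailSet_par']
  refine Iff.trans ?_ Finset.mem_union.symm
  refine Iff.trans ?_ (or_congr Finset.mem_union Iff.rfl).symm
  refine Iff.trans ?_ (or_congr (or_congr Finset.mem_product Finset.mem_product) Finset.mem_product).symm
  rw [mem_rSet, mem_bSet, mem_cellSet, mem_tailSet_iff, mem_tailSet_iff, mem_tailSet_iff]
  have := hX p.1
  omega

/-- `#E(1,1) = a T_Y(0,1) + a T_Y(1,0) + c T_Y(1,1)` -/
theorem tailCount_par_11_left (hX : FlowOne X) :
    tailCount (V2Closure.SP.par X Y) 1 1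
      = (rSet X).card * tailCount Y 0 1 + (rSet X).card * tailCount Y 1 0
        + (cellSet X).card * tailCount Y 1 1 := by
  rw [tailCount_eq_card, tailSet_par_11_left X Y hX]
  show (((rSet X ×ˢ tailSet Y 0 1 : Finset (X.Conf × Y.Conf))
      ∪ (bSet X ×ˢ tailSet Y 1 0 : Finset (X.Conf × Y.Conf)))
      ∪ (cellSet X ×ˢ tailSet Y 1 1 : Finset (X.Conf × Y.Conf))).card = _
  rw [Finset.card_union_of_disjoint, Finset.card_union_of_disjoint, Finset.card_product, Finset.card_product,
    Finset.card_product, card_bSet_eq, tailCount_eq_card, tailCount_eq_card, tailCount_eq_card]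
  · rw [Finset.disjoint_left]
    intro p h1 h2
    rw [Finset.mem_product, mem_rSet] at h1
    rw [Finset.mem_product, mem_bSet] at h2
    have := hX p.1
    omega
  · rw [Finset.disjoint_left]
    intro p h1 h2
    rw [Finset.mem_union, Finset.mem_product, Finset.mem_product, mem_rSet, mem_bSet] at h1
    rw [Finset.mem_product, mem_cellSet] at h2
    omega

/-- `E(1,0)` of `X ∥ Y` for flow-one `X`: `R × all ⊔ col × E_Y(1,0)` -/
theorem tailSet_par_10_left (hX : FlowOne X) :
    tailSet (V2Closure.SP.par X Y) 1 0
      = ((rSet X ×ˢ (Finset.univ : Finset Y.Conf) : Finset (X.Conf × Y.Conf))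
          ∪ (colSet X ×ˢ tailSet Y 1 0 : Finset (X.Conf × Y.Conf))) := by
  apply Finset.ext; intro p
  rw [mem_tailSet_par']
  refine Iff.trans ?_ Finset.mem_union.symm
  refine Iff.trans ?_ (or_congr Finset.mem_product Finset.mem_product).symm
  rw [mem_rSet, mem_colSet, mem_tailSet_iff]
  have := hX p.1
  simp only [Finset.mem_univ, and_true]
  omega

/-- `#E(1,0) = a #all_Y + (n − a) T_Y(1,0)` -/
theorem tailCount_par_10_left (hX : FlowOne X) :
    tailCount (V2Closure.SP.par X Y) 1 0
      = (rSet X).card * Fintype.card Y.Conf + (Fintype.card X.Conf - (rSet X).card) * tailCount Y 1 0 := by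
  rw [tailCount_eq_card, tailSet_par_10_left X Y hX]
  show ((rSet X ×ˢ (Finset.univ : Finset Y.Conf) : Finset (X.Conf × Y.Conf))
      ∪ (colSet X ×ˢ tailSet Y 1 0 : Finset (X.Conf × Y.Conf))).card = _
  rw [Finset.card_union_of_disjoint, Finset.card_product, Finset.card_product, Finset.card_univ, card_colSet X hX,
    tailCount_eq_card]
  rw [Finset.disjoint_left]
  intro p h1 h2
  rw [Finset.mem_product, mem_rSet] at h1
  rw [Finset.mem_product, mem_colSet] at h2
  omega

end Counts

end Summit.Ventures.PercRepro2.Tail2D
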